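import Summits.QuantumFields.YangMills.Theorems.BalabanStepParabolic.Negative.FibreSlaving

/-!
# `BalabanStepParabolic` — negative-side support XIV: the FORCED scaling limit (any inhabitant, odd `M`)

Support file for crux `stmt-QuantumFields-9684` (`ParabolicTrajectory.BalabanStepParabolic`), extracted from the
standing disprover's work file `Cruxes/BalabanStepParabolic/Disproof.lean` §V (cycle 3); continuation of
`FibreSlaving.lean` (§V.1–§V.3: cone dichotomy, deep-orbit region). Tree objects only.

* §V.4 `deep_pair_estimate`, `deep_orbit_cauchySeq`, `deep_orbit_tendsto`, `deep_limit_unique`: deep Wilson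
  orbit points are `λ`-Lipschitz functions of their coupling up to `ϑ^{depth}·2δ`; deep sequences with Cauchy
  (resp. convergent) arrival couplings are Cauchy (resp. convergent in the chart `[0,δ] × B̄_R`), WHATEVER the
  Banach space `E`; the limit depends on the arrival coupling only.
* §V.5 **`forced_scaling_limit`** (odd `M`): there are `g⋆ > 0` and a graph `Q : ℝ → [0,δ] × B̄_R` such that
  along EVERY admissible deep sequence of Wilson orbit points (`0 < g_j ≤ g⋆`, depths `k_j → ∞` in the window
  `2c₁k_j ≤ 1/g_j² − 1/g⋆²`, arrival couplings `→ t`) the points converge to `Q t` and the GENUINE centred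
  Wilson `n`-point functions (`β_j = betaOf g_j → ∞`, tori `M^{k_j}(2L+1) → ∞`, `k_j`-fold dilated test
  functions, normalisations `c g_j`) CONVERGE to `expect (Q t) (2L+1) n σ f`.

Consequence for the crux: field (4c) is, for every inhabitant and every `E`, the existence of a
continuum/thermodynamic limit of dilated plaquette correlators along the inhabitant's own tuning, consistent
across all tunings with the same arrival coupling. This mechanises — and strengthens from "some subsequence"
to "every admissible sequence, limit a function of the coupling" — the forced-accumulation note of PICKED.md;
a refutation of the crux must exhibit non-convergence for every admissible `(φ, Ψ, yW, betaOf, c)`.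
-/

namespace Summit.QuantumFields.YangMills.Theorems.BalabanStepParabolic.Negative

open scoped SchwartzMap
open MeasureTheory Filter Topology
open Literature.MathematicalPhysics.QuantumFieldTheory Literature.MathematicalPhysics.AQFT
open Literature.MathematicalPhysics.QuantumLattice

noncomputable section

variable {G : Type} [Group G] [TopologicalSpace G] [IsTopologicalGroup G] [CompactSpace G]
  [MeasurableSpace G] [BorelSpace G] {r : LatticeRep G} {M : ℕ} (S : BalabanBanachStep G r M)

/-! ### §V.4  Deep sequences with convergent arrival couplings are Cauchy, hence convergent -/

/-- **Pair estimate for deep orbit points.** With the thresholds `τ₀`, `i₀`: two admissible Wilson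
orbit points (`0 < g ≤ τ₀`, `2c₁ k ≤ 1/g² − 1/τ₀²`) of depths `k, k' ≥ m₀ + i₀` satisfy
`‖Δy‖ ≤ λ |Δg| + ϑ^{m₀} · 2δ` (`λ = 2C(2τ₀+δ)/(1−θ')`, `ϑ = (1+θ')/2`): up to an error exponentially
small in the depth, the fibre coordinate of a deep orbit point is a `λ`-Lipschitz function of its
coupling coordinate — for EVERY inhabitant and every Banach space `E`. [folklore] -/
theorem deep_pair_estimate {τ₀ : ℝ} (hτs : τ₀ ≤ (min S.δ (min (Real.sqrt (1 / (2 * (S.b + S.C * (S.δ + S.R))))) (Real.sqrt ((1 - S.θ') * S.R / S.C))))) (hτg₀ : τ₀ ≤ S.g₀)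
    (hτδ2 : S.C * τ₀ ^ 2 / (1 - S.θ') ≤ S.δ / 2)
    (hsmall : S.C * τ₀ ^ 2 * (τ₀ + S.δ) + S.C * τ₀ ^ 3 * (2 * S.C * (2 * τ₀ + S.δ) / (1 - S.θ')) ≤
      (1 - S.θ') / 2)
    {i₀ : ℕ} (hi₀ : S.θ' ^ i₀ * S.R ≤ S.δ / 2)
    {g g' : ℝ} (hg : 0 < g ∧ g ≤ τ₀) (hg' : 0 < g' ∧ g' ≤ τ₀) {k k' m₀ : ℕ}
    (hk : 2 * (S.b + S.C * (S.δ + S.R)) * k ≤ 1 / g ^ 2 - 1 / τ₀ ^ 2) (hk' : 2 * (S.b + S.C * (S.δ + S.R)) * k' ≤ 1 / g' ^ 2 - 1 / τ₀ ^ 2)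
    (hmk : m₀ + i₀ ≤ k) (hmk' : m₀ + i₀ ≤ k') :
    ‖(S.F^[k] (g, S.yW g)).2 - (S.F^[k'] (g', S.yW g')).2‖ ≤
      (2 * S.C * (2 * τ₀ + S.δ) / (1 - S.θ')) * |(S.F^[k] (g, S.yW g)).1 - (S.F^[k'] (g', S.yW g')).1| +
        ((1 + S.θ') / 2) ^ m₀ * (2 * S.δ) := by
  have hθ'0 := S.θ'_nonneg
  have hθ'1 : 0 < 1 - S.θ' := by linarith [S.θ'_lt_one]
  have hτδ : τ₀ ≤ S.δ := hτs.trans (gₛ_le_δ S)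
  have hτ0 : 0 ≤ τ₀ := hg.1.le.trans hg.2
  -- split off the last m₀ steps
  set p := S.F^[k - m₀] (g, S.yW g) with hp
  set q := S.F^[k' - m₀] (g', S.yW g') with hq
  have hP : S.F^[k] (g, S.yW g) = S.F^[m₀] p := by
    rw [hp, ← Function.iterate_add_apply, Nat.add_sub_cancel' (by omega)]
  have hP' : S.F^[k'] (g', S.yW g') = S.F^[m₀] q := by
    rw [hq, ← Function.iterate_add_apply, Nat.add_sub_cancel' (by omega)]
  obtain ⟨hA, hB⟩ := deep_region S hτs hτg₀ hτδ2 hi₀ hg.1 hg.2 k hk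
  obtain ⟨hA', hB'⟩ := deep_region S hτs hτg₀ hτδ2 hi₀ hg'.1 hg'.2 k' hk'
  have hsegp : ∀ i < m₀, (S.F^[i] p).1 ∈ Set.Icc 0 τ₀ ∧ ‖(S.F^[i] p).2‖ ≤ S.δ := by
    intro i hi
    have e : S.F^[i] p = S.F^[k - m₀ + i] (g, S.yW g) := by
      rw [hp, ← Function.iterate_add_apply, add_comm]
    rw [e]
    exact ⟨(hA _ (by omega)).1, hB _ (by omega) (by omega)⟩
  have hsegq : ∀ i < m₀, (S.F^[i] q).1 ∈ Set.Icc 0 τ₀ ∧ ‖(S.F^[i] q).2‖ ≤ S.δ := by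
    intro i hi
    have e : S.F^[i] q = S.F^[k' - m₀ + i] (g', S.yW g') := by
      rw [hq, ← Function.iterate_add_apply, add_comm]
    rw [e]
    exact ⟨(hA' _ (by omega)).1, hB' _ (by omega) (by omega)⟩
  have hslave := slaving_estimate S hτ0 hτδ hsmall p q m₀ hsegp hsegq
  rw [← hP, ← hP'] at hslave
  have hp2 : ‖p.2‖ ≤ S.δ := by
    have := hB (k - m₀) (by omega) (by omega); rwa [hp]
  have hq2 : ‖q.2‖ ≤ S.δ := by
    have := hB' (k' - m₀) (by omega) (by omega); rwa [hq]
  have hpq : ‖p.2 - q.2‖ ≤ 2 * S.δ := (norm_sub_le _ _).trans (by linarith)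
  have hϑ0 : 0 ≤ ((1 + S.θ') / 2) ^ m₀ := by positivity
  nlinarith [hslave, mul_le_mul_of_nonneg_left hpq hϑ0]

/-- **Deep orbit points are Cauchy when their couplings are.** With the thresholds `τ₀`, `i₀`:
for admissible Wilson orbit points `P_j = F^{k_j}(g_j, yW g_j)` with depths `k_j → ∞`, if the
arrival couplings `(P_j).1` form a Cauchy sequence then so do the points `P_j` in `ℝ × E` —
WHATEVER the Banach space `E`: the fibre is slaved to the coupling. [folklore] -/
theorem deep_orbit_cauchySeq {τ₀ : ℝ} (hτs : τ₀ ≤ (min S.δ (min (Real.sqrt (1 / (2 * (S.b + S.C * (S.δ + S.R))))) (Real.sqrt ((1 - S.θ') * S.R / S.C))))) (hτg₀ : τ₀ ≤ S.g₀)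
    (hτδ2 : S.C * τ₀ ^ 2 / (1 - S.θ') ≤ S.δ / 2)
    (hsmall : S.C * τ₀ ^ 2 * (τ₀ + S.δ) + S.C * τ₀ ^ 3 * (2 * S.C * (2 * τ₀ + S.δ) / (1 - S.θ')) ≤
      (1 - S.θ') / 2)
    {i₀ : ℕ} (hi₀ : S.θ' ^ i₀ * S.R ≤ S.δ / 2)
    (g : ℕ → ℝ) (k : ℕ → ℕ) (hg : ∀ j, 0 < g j ∧ g j ≤ τ₀)
    (hk : ∀ j, 2 * (S.b + S.C * (S.δ + S.R)) * (k j) ≤ 1 / (g j) ^ 2 - 1 / τ₀ ^ 2) (hkinf : Tendsto k atTop atTop)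
    (hc : CauchySeq fun j => (S.F^[k j] (g j, S.yW (g j))).1) :
    CauchySeq fun j => S.F^[k j] (g j, S.yW (g j)) := by
  have hθ'0 := S.θ'_nonneg
  have hθ'1 : 0 < 1 - S.θ' := by linarith [S.θ'_lt_one]
  have hC := S.C_pos.le
  have hδ := S.δ_pos
  have hτ0 : 0 ≤ τ₀ := (hg 0).1.le.trans (hg 0).2
  set lam := 2 * S.C * (2 * τ₀ + S.δ) / (1 - S.θ') with hlam
  set ϑ := (1 + S.θ') / 2 with hϑ
  have hlam0 : 0 ≤ lam := by rw [hlam]; apply div_nonneg (by nlinarith) hθ'1.le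
  have hϑ0 : 0 ≤ ϑ := by rw [hϑ]; linarith
  have hϑ1 : ϑ < 1 := by rw [hϑ]; linarith [S.θ'_lt_one]
  rw [Metric.cauchySeq_iff] at hc ⊢
  intro ε hε
  have hpow := (tendsto_pow_atTop_nhds_zero_of_lt_one hϑ0 hϑ1).mul_const (2 * S.δ)
  rw [zero_mul] at hpow
  obtain ⟨m₀, hm₀⟩ := (hpow.eventually (eventually_lt_nhds (half_pos hε))).exists
  obtain ⟨N₂, hN₂⟩ := hc (ε / (2 * (lam + 1))) (by positivity)
  obtain ⟨N₁, hN₁⟩ := (hkinf.eventually (eventually_ge_atTop (m₀ + i₀))).exists_forall_of_atTop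
  refine ⟨max N₁ N₂, fun j hj j' hj' => ?_⟩
  have hpair := deep_pair_estimate S hτs hτg₀ hτδ2 hsmall hi₀ (hg j) (hg j') (hk j) (hk j')
    (hN₁ j ((le_max_left _ _).trans hj)) (hN₁ j' ((le_max_left _ _).trans hj'))
  have hcpl : dist (S.F^[k j] (g j, S.yW (g j))).1 (S.F^[k j'] (g j', S.yW (g j'))).1 <
      ε / (2 * (lam + 1)) := hN₂ j ((le_max_right _ _).trans hj) j' ((le_max_right _ _).trans hj')
  rw [Real.dist_eq] at hcpl
  have hε2 : ε / (2 * (lam + 1)) ≤ ε / 2 :=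
    div_le_div_of_nonneg_left hε.le (by norm_num) (by nlinarith)
  have hfib : ‖(S.F^[k j] (g j, S.yW (g j))).2 - (S.F^[k j'] (g j', S.yW (g j'))).2‖ < ε := by
    have h1 : lam * |(S.F^[k j] (g j, S.yW (g j))).1 - (S.F^[k j'] (g j', S.yW (g j'))).1| ≤
        lam * (ε / (2 * (lam + 1))) := mul_le_mul_of_nonneg_left hcpl.le hlam0
    have h2 : lam * (ε / (2 * (lam + 1))) ≤ ε / 2 := by
      rw [mul_div_assoc', div_le_div_iff₀ (by positivity) (by norm_num)]
      nlinarith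
    linarith [hpair, hm₀]
  rw [Prod.dist_eq, Real.dist_eq, dist_eq_norm]
  exact max_lt (hcpl.trans_le (hε2.trans (by linarith))) hfib

/-- **Forced convergence of deep orbit points.** Same setting; if the arrival couplings
CONVERGE then the orbit points converge, to a point of the chart `[0, δ] × B̄_R`. [folklore] -/
theorem deep_orbit_tendsto {τ₀ : ℝ} (hτs : τ₀ ≤ (min S.δ (min (Real.sqrt (1 / (2 * (S.b + S.C * (S.δ + S.R))))) (Real.sqrt ((1 - S.θ') * S.R / S.C))))) (hτg₀ : τ₀ ≤ S.g₀)
    (hτδ2 : S.C * τ₀ ^ 2 / (1 - S.θ') ≤ S.δ / 2)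
    (hsmall : S.C * τ₀ ^ 2 * (τ₀ + S.δ) + S.C * τ₀ ^ 3 * (2 * S.C * (2 * τ₀ + S.δ) / (1 - S.θ')) ≤
      (1 - S.θ') / 2)
    {i₀ : ℕ} (hi₀ : S.θ' ^ i₀ * S.R ≤ S.δ / 2)
    (g : ℕ → ℝ) (k : ℕ → ℕ) (hg : ∀ j, 0 < g j ∧ g j ≤ τ₀)
    (hk : ∀ j, 2 * (S.b + S.C * (S.δ + S.R)) * (k j) ≤ 1 / (g j) ^ 2 - 1 / τ₀ ^ 2) (hkinf : Tendsto k atTop atTop)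
    {t : ℝ} (hc : Tendsto (fun j => (S.F^[k j] (g j, S.yW (g j))).1) atTop (𝓝 t)) :
    ∃ q ∈ Set.Icc 0 S.δ ×ˢ Metric.closedBall (0 : S.E) S.R,
      Tendsto (fun j => S.F^[k j] (g j, S.yW (g j))) atTop (𝓝 q) := by
  have hCauchy := deep_orbit_cauchySeq S hτs hτg₀ hτδ2 hsmall hi₀ g k hg hk hkinf hc.cauchySeq
  obtain ⟨q, hq⟩ := cauchySeq_tendsto_of_complete hCauchy
  refine ⟨q, ?_, hq⟩
  have hclosed : IsClosed (Set.Icc 0 S.δ ×ˢ Metric.closedBall (0 : S.E) S.R) :=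
    isClosed_Icc.prod Metric.isClosed_closedBall
  refine hclosed.mem_of_tendsto hq (Eventually.of_forall fun j => ?_)
  have hτδ : τ₀ ≤ S.δ := hτs.trans (gₛ_le_δ S)
  obtain ⟨hA, -⟩ := deep_region S hτs hτg₀ hτδ2 hi₀ (hg j).1 (hg j).2 (k j) (hk j)
  obtain ⟨h1, h2⟩ := hA (k j) le_rfl
  exact Set.mk_mem_prod ⟨h1.1, h1.2.trans hτδ⟩
    (by simpa [Metric.mem_closedBall, dist_zero_right] using h2)

/-- **The limit depends on the arrival coupling only.** Two admissible deep sequences whose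
arrival couplings converge to the SAME `t` have the same limit point in `ℝ × E`. [folklore] -/
theorem deep_limit_unique {τ₀ : ℝ} (hτs : τ₀ ≤ (min S.δ (min (Real.sqrt (1 / (2 * (S.b + S.C * (S.δ + S.R))))) (Real.sqrt ((1 - S.θ') * S.R / S.C))))) (hτg₀ : τ₀ ≤ S.g₀)
    (hτδ2 : S.C * τ₀ ^ 2 / (1 - S.θ') ≤ S.δ / 2)
    (hsmall : S.C * τ₀ ^ 2 * (τ₀ + S.δ) + S.C * τ₀ ^ 3 * (2 * S.C * (2 * τ₀ + S.δ) / (1 - S.θ')) ≤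
      (1 - S.θ') / 2)
    {i₀ : ℕ} (hi₀ : S.θ' ^ i₀ * S.R ≤ S.δ / 2)
    {g g' : ℕ → ℝ} {k k' : ℕ → ℕ} (hg : ∀ j, 0 < g j ∧ g j ≤ τ₀) (hg' : ∀ j, 0 < g' j ∧ g' j ≤ τ₀)
    (hk : ∀ j, 2 * (S.b + S.C * (S.δ + S.R)) * (k j) ≤ 1 / (g j) ^ 2 - 1 / τ₀ ^ 2)
    (hk' : ∀ j, 2 * (S.b + S.C * (S.δ + S.R)) * (k' j) ≤ 1 / (g' j) ^ 2 - 1 / τ₀ ^ 2)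
    (hkinf : Tendsto k atTop atTop) (hkinf' : Tendsto k' atTop atTop) {t : ℝ} {q q' : ℝ × S.E}
    (hc : Tendsto (fun j => (S.F^[k j] (g j, S.yW (g j))).1) atTop (𝓝 t))
    (hc' : Tendsto (fun j => (S.F^[k' j] (g' j, S.yW (g' j))).1) atTop (𝓝 t))
    (hq : Tendsto (fun j => S.F^[k j] (g j, S.yW (g j))) atTop (𝓝 q))
    (hq' : Tendsto (fun j => S.F^[k' j] (g' j, S.yW (g' j))) atTop (𝓝 q')) : q = q' := by
  have hθ'0 := S.θ'_nonneg
  have hθ'1 : 0 < 1 - S.θ' := by linarith [S.θ'_lt_one]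
  have hϑ0 : 0 ≤ (1 + S.θ') / 2 := by linarith
  have hϑ1 : (1 + S.θ') / 2 < 1 := by linarith [S.θ'_lt_one]
  -- first coordinates agree
  have h1 : q.1 = t := tendsto_nhds_unique hq.fst_nhds hc
  have h1' : q'.1 = t := tendsto_nhds_unique hq'.fst_nhds hc'
  -- fibres: ‖q.2 - q'.2‖ ≤ ϑ^m₀ (2δ) for every m₀
  have h2 : ∀ m₀ : ℕ, ‖q.2 - q'.2‖ ≤ ((1 + S.θ') / 2) ^ m₀ * (2 * S.δ) := by
    intro m₀
    have hev : ∀ᶠ j in atTop, ‖(S.F^[k j] (g j, S.yW (g j))).2 - (S.F^[k' j] (g' j, S.yW (g' j))).2‖ ≤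
        (2 * S.C * (2 * τ₀ + S.δ) / (1 - S.θ')) *
          |(S.F^[k j] (g j, S.yW (g j))).1 - (S.F^[k' j] (g' j, S.yW (g' j))).1| +
        ((1 + S.θ') / 2) ^ m₀ * (2 * S.δ) := by
      filter_upwards [hkinf.eventually (eventually_ge_atTop (m₀ + i₀)),
        hkinf'.eventually (eventually_ge_atTop (m₀ + i₀))] with j hj hj'
      exact deep_pair_estimate S hτs hτg₀ hτδ2 hsmall hi₀ (hg j) (hg' j) (hk j) (hk' j) hj hj'
    have hlim1 : Tendsto (fun j => ‖(S.F^[k j] (g j, S.yW (g j))).2 -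
        (S.F^[k' j] (g' j, S.yW (g' j))).2‖) atTop (𝓝 ‖q.2 - q'.2‖) :=
      (hq.snd_nhds.sub hq'.snd_nhds).norm
    have hlim2 : Tendsto (fun j => (2 * S.C * (2 * τ₀ + S.δ) / (1 - S.θ')) *
          |(S.F^[k j] (g j, S.yW (g j))).1 - (S.F^[k' j] (g' j, S.yW (g' j))).1| +
        ((1 + S.θ') / 2) ^ m₀ * (2 * S.δ)) atTop
        (𝓝 ((2 * S.C * (2 * τ₀ + S.δ) / (1 - S.θ')) * |t - t| + ((1 + S.θ') / 2) ^ m₀ * (2 * S.δ))) := by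
      have h := ((hc.sub hc').abs).const_mul (2 * S.C * (2 * τ₀ + S.δ) / (1 - S.θ'))
      exact h.add_const _
    have := le_of_tendsto_of_tendsto hlim1 hlim2 hev
    simpa using this
  have h3 : ‖q.2 - q'.2‖ ≤ 0 := by
    have hpow := (tendsto_pow_atTop_nhds_zero_of_lt_one hϑ0 hϑ1).mul_const (2 * S.δ)
    rw [zero_mul] at hpow
    exact ge_of_tendsto' hpow h2
  have h4 : q.2 = q'.2 := by
    have : ‖q.2 - q'.2‖ = 0 := le_antisymm h3 (norm_nonneg _)
    exact sub_eq_zero.1 (norm_eq_zero.1 this)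
  exact Prod.ext (h1.trans h1'.symm) h4

/-- **Deep sequences exist (non-vacuity).** With the thresholds `τ₀`: the Wilson couplings
`g_j = τ₀/(j+2) → 0⁺` with maximal admissible depths `k_j = ⌊(1/g_j² − 1/τ₀²)/(2c₁)⌋ → ∞` have arrival
couplings in the compact interval `[0, τ₀]`, so a subsequence is an admissible deep sequence with
CONVERGENT arrival couplings. [folklore] -/
theorem exists_deep_sequence {τ₀ : ℝ} (hτ0 : 0 < τ₀) (hτs : τ₀ ≤ (min S.δ (min (Real.sqrt (1 / (2 * (S.b + S.C * (S.δ + S.R))))) (Real.sqrt ((1 - S.θ') * S.R / S.C))))) (hτg₀ : τ₀ ≤ S.g₀) :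
    ∃ (g : ℕ → ℝ) (k : ℕ → ℕ) (t : ℝ), (∀ j, 0 < g j ∧ g j ≤ τ₀) ∧
      (∀ j, 2 * (S.b + S.C * (S.δ + S.R)) * (k j) ≤ 1 / (g j) ^ 2 - 1 / τ₀ ^ 2) ∧
      Tendsto k atTop atTop ∧ Tendsto (fun j => (S.F^[k j] (g j, S.yW (g j))).1) atTop (𝓝 t) := by
  have hc₁ := c₁_pos S
  set g : ℕ → ℝ := fun j => τ₀ / (j + 2) with hg
  set k : ℕ → ℕ := fun j => ⌊(1 / (g j) ^ 2 - 1 / τ₀ ^ 2) / (2 * (S.b + S.C * (S.δ + S.R)))⌋₊ with hk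
  have hgpos : ∀ j, 0 < g j := fun j => by rw [hg]; positivity
  have hgle : ∀ j, g j ≤ τ₀ := fun j => by
    rw [hg]
    exact div_le_self hτ0.le (by have := (Nat.cast_nonneg j : (0 : ℝ) ≤ j); linarith)
  have hwin : ∀ j, 2 * (S.b + S.C * (S.δ + S.R)) * (k j) ≤ 1 / (g j) ^ 2 - 1 / τ₀ ^ 2 := by
    intro j
    have hnn : 0 ≤ (1 / (g j) ^ 2 - 1 / τ₀ ^ 2) / (2 * (S.b + S.C * (S.δ + S.R))) := by
      apply div_nonneg _ (by positivity)
      have : 1 / τ₀ ^ 2 ≤ 1 / (g j) ^ 2 := by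
        apply one_div_le_one_div_of_le (by have := hgpos j; positivity)
        exact pow_le_pow_left₀ (hgpos j).le (hgle j) 2
      linarith
    have hfl : (k j : ℝ) ≤ (1 / (g j) ^ 2 - 1 / τ₀ ^ 2) / (2 * (S.b + S.C * (S.δ + S.R))) := Nat.floor_le hnn
    calc 2 * (S.b + S.C * (S.δ + S.R)) * (k j : ℝ) ≤ 2 * (S.b + S.C * (S.δ + S.R)) * ((1 / (g j) ^ 2 - 1 / τ₀ ^ 2) / (2 * (S.b + S.C * (S.δ + S.R)))) := by
          gcongr
      _ = 1 / (g j) ^ 2 - 1 / τ₀ ^ 2 := by field_simp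
  -- depths tend to infinity
  have hkinf : Tendsto k atTop atTop := by
    have h1 : Tendsto (fun j : ℕ => (1 / (g j) ^ 2 - 1 / τ₀ ^ 2) / (2 * (S.b + S.C * (S.δ + S.R)))) atTop atTop := by
      have e : ∀ j : ℕ, (1 / (g j) ^ 2 - 1 / τ₀ ^ 2) / (2 * (S.b + S.C * (S.δ + S.R))) =
          ((j : ℝ) + 2) ^ 2 * (1 / (τ₀ ^ 2 * (2 * (S.b + S.C * (S.δ + S.R))))) + (-(1 / τ₀ ^ 2) / (2 * (S.b + S.C * (S.δ + S.R)))) := by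
        intro j; rw [hg]; field_simp; ring
      simp_rw [e]
      refine tendsto_atTop_add_const_right _ _ (Tendsto.atTop_mul_const (by positivity) ?_)
      have h2 : Tendsto (fun j : ℕ => (j : ℝ) + 2) atTop atTop :=
        tendsto_atTop_add_const_right _ _ tendsto_natCast_atTop_atTop
      exact (tendsto_pow_atTop two_ne_zero).comp h2
    exact tendsto_nat_floor_atTop.comp h1
  -- arrival couplings live in the compact interval [0, τ₀]
  have hmem : ∀ j, (S.F^[k j] (g j, S.yW (g j))).1 ∈ Set.Icc 0 τ₀ := by
    intro j
    have hw := orbit_window S hτs (hgpos j) (hgle j) ((hgle j).trans hτg₀) (k j) (hwin j) (k j) le_rfl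
    exact ⟨hw.1.le, hw.2.1⟩
  obtain ⟨t, -, ψ, hψ, hlim⟩ := isCompact_Icc.tendsto_subseq hmem
  refine ⟨g ∘ ψ, k ∘ ψ, t, fun j => ⟨hgpos _, hgle _⟩, fun j => hwin _,
    hkinf.comp hψ.tendsto_atTop, hlim⟩

/-! ### §V.5  The headline: (4c) forces a scaling limit of genuine Wilson data along the tuning -/

/-- **FORCED SCALING LIMIT (any inhabitant, odd `M`).** For every inhabitant `S` of
`BalabanBanachStep G r M` with `M` odd there are a coupling threshold `g⋆ ∈ (0, min δ g₀]` and a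
map `Q : ℝ → [0, δ] × B̄_R` ("the deep orbit closure is a graph over the coupling axis") such that
admissible deep sequences with convergent arrival couplings EXIST (`exists_deep_sequence`) and
for EVERY admissible deep sequence of Wilson orbit points — bare couplings `0 < g_j ≤ g⋆`, depths
`k_j → ∞` inside the window `2c₁ k_j ≤ 1/g_j² − 1/g⋆²` (so the orbit is in the chart, §L), arrival
couplings `→ t` — (i) the orbit points converge to `Q t` in `ℝ × E`, and (ii) the GENUINE centred
Wilson `n`-point functions at inverse coupling `betaOf g_j → ∞`, on the tori `M^{k_j}(2L+1) → ∞`,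
with `k_j`-fold block-dilated test functions, CONVERGE, to `expect (Q t) (2L+1) n σ f` — a limit
depending on the arrival coupling `t` alone. So field (4c) of the crux is, for every inhabitant
and every choice of the Banach space `E`, the EXISTENCE OF A CONTINUUM/THERMODYNAMIC LIMIT of
dilated plaquette correlators along the inhabitant's own tuning `β = betaOf g`, consistently
across all tunings landing at the same chart coupling; a refutation of the crux must show that
no admissible tuning has such a limit. [folklore] -/
theorem forced_scaling_limit (hM : Odd M) :
    ∃ gstar : ℝ, 0 < gstar ∧ gstar ≤ S.g₀ ∧ gstar ≤ S.δ ∧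
    (∃ (g : ℕ → ℝ) (k : ℕ → ℕ) (t : ℝ), (∀ j, 0 < g j ∧ g j ≤ gstar) ∧
      (∀ j, 2 * (S.b + S.C * (S.δ + S.R)) * (k j) ≤ 1 / (g j) ^ 2 - 1 / gstar ^ 2) ∧
      Tendsto k atTop atTop ∧ Tendsto (fun j => (S.F^[k j] (g j, S.yW (g j))).1) atTop (𝓝 t)) ∧
    ∃ Q : ℝ → ℝ × S.E, (∀ t, Q t ∈ Set.Icc 0 S.δ ×ˢ Metric.closedBall (0 : S.E) S.R) ∧
    ∀ (g : ℕ → ℝ) (k : ℕ → ℕ) (t : ℝ),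
      (∀ j, 0 < g j ∧ g j ≤ gstar) →
      (∀ j, 2 * (S.b + S.C * (S.δ + S.R)) * (k j) ≤ 1 / (g j) ^ 2 - 1 / gstar ^ 2) →
      Tendsto k atTop atTop →
      Tendsto (fun j => (S.F^[k j] (g j, S.yW (g j))).1) atTop (𝓝 t) →
      Tendsto (fun j => S.F^[k j] (g j, S.yW (g j))) atTop (𝓝 (Q t)) ∧
      ∀ (L n : ℕ) (σ : Fin n → YMSpecies G) (f : Fin n → 𝓢(EuclideanSpace ℝ (Fin 4), ℝ)),
        IsOffDiagonal (SchwartzMap.tensorFin n fun i => ofRealTest (f i)) →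
        Tendsto (fun j => wilsonCentredSchwinger r.ρ (S.betaOf (g j))
            ((M ^ (k j) * (2 * L + 1) - 1) / 2) (S.c (g j)) n σ
            (fun i => (blockDilate M)^[k j] (f i))) atTop
          (𝓝 (S.expect (Q t) (2 * L + 1) n σ f)) := by
  classical
  obtain ⟨τ₀, hτ0, hτs, hτg₀, hτδ2, hsmall⟩ := exists_τ₀ S
  obtain ⟨i₀, hi₀⟩ := exists_i₀ S
  have hτδ : τ₀ ≤ S.δ := hτs.trans (gₛ_le_δ S)
  -- admissibility of a pair of sequences with arrival coupling `t`
  let Adm : (ℕ → ℝ) → (ℕ → ℕ) → ℝ → Prop := fun g k t =>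
    (∀ j, 0 < g j ∧ g j ≤ τ₀) ∧ (∀ j, 2 * (S.b + S.C * (S.δ + S.R)) * (k j) ≤ 1 / (g j) ^ 2 - 1 / τ₀ ^ 2) ∧
      Tendsto k atTop atTop ∧ Tendsto (fun j => (S.F^[k j] (g j, S.yW (g j))).1) atTop (𝓝 t)
  have hlim : ∀ g k t, Adm g k t → ∃ q ∈ Set.Icc 0 S.δ ×ˢ Metric.closedBall (0 : S.E) S.R,
      Tendsto (fun j => S.F^[k j] (g j, S.yW (g j))) atTop (𝓝 q) :=
    fun g k t h => deep_orbit_tendsto S hτs hτg₀ hτδ2 hsmall hi₀ g k h.1 h.2.1 h.2.2.1 h.2.2.2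
  -- the graph `Q`
  let Q : ℝ → ℝ × S.E := fun t =>
    if h : ∃ gk : (ℕ → ℝ) × (ℕ → ℕ), Adm gk.1 gk.2 t then
      Classical.choose (hlim _ _ t (Classical.choose_spec h))
    else (0, S.yW 0)
  have hQmem : ∀ t, Q t ∈ Set.Icc 0 S.δ ×ˢ Metric.closedBall (0 : S.E) S.R := by
    intro t
    by_cases h : ∃ gk : (ℕ → ℝ) × (ℕ → ℕ), Adm gk.1 gk.2 t
    · simp only [Q, dif_pos h]
      exact (Classical.choose_spec (hlim _ _ t (Classical.choose_spec h))).1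
    · simp only [Q, dif_neg h]
      exact S.wilson_mem_chart le_rfl S.δ_pos.le S.g₀_pos.le
  refine ⟨τ₀, hτ0, hτg₀, hτδ, exists_deep_sequence S hτ0 hτs hτg₀, Q, hQmem,
    fun g k t hg hk hkinf hc => ?_⟩
  have hadm : Adm g k t := ⟨hg, hk, hkinf, hc⟩
  have hex : ∃ gk : (ℕ → ℝ) × (ℕ → ℕ), Adm gk.1 gk.2 t := ⟨(g, k), hadm⟩
  -- the chosen sequence and its limit
  have hch := Classical.choose_spec hex
  have hchlim := Classical.choose_spec (hlim _ _ t hch)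
  have hQt : Q t = Classical.choose (hlim _ _ t hch) := by simp only [Q, dif_pos hex]
  -- our sequence converges to some q', equal to Q t by uniqueness
  obtain ⟨q', -, hq'⟩ := hlim g k t hadm
  have heq : q' = Q t := by
    rw [hQt]
    exact deep_limit_unique S hτs hτg₀ hτδ2 hsmall hi₀ hg hch.1 hk hch.2.1 hkinf hch.2.2.1 hc
      hch.2.2.2 hq' hchlim.2
  have hconv : Tendsto (fun j => S.F^[k j] (g j, S.yW (g j))) atTop (𝓝 (Q t)) := heq ▸ hq'
  refine ⟨hconv, fun L n σ f hf => ?_⟩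
  have hgI : ∀ j, g j ∈ Set.Ioc 0 S.g₀ := fun j => ⟨(hg j).1, (hg j).2.trans hτg₀⟩
  have hkI : ∀ j, ∀ i ≤ k j, (S.F^[i] (g j, S.yW (g j))).1 ∈ Set.Icc 0 S.δ ∧
      ‖(S.F^[i] (g j, S.yW (g j))).2‖ ≤ S.R := by
    intro j i hi
    obtain ⟨hA, -⟩ := deep_region S hτs hτg₀ hτδ2 hi₀ (hg j).1 (hg j).2 (k j) (hk j)
    exact ⟨⟨(hA i hi).1.1, (hA i hi).1.2.trans hτδ⟩, (hA i hi).2⟩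
  exact tendsto_wilson_of_tendsto_orbit S hM hgI hkI (hQmem t) hconv L n σ f hf

end

end Summit.QuantumFields.YangMills.Theorems.BalabanStepParabolic.Negative
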